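import Literature.Analysis.FluidPDE.PressureRepresentation
import Literature.Analysis.FluidPDE.RieszKernelBounds
import HarnessLib

/-!
# Tools for the far-field pressure of local Leray solutions: the two-centre bound for the
pressure kernel, weighted integrals of uniformly locally `L²` fields, the tail of `∫ |z|⁻⁴`

Analysis/FluidPDE support file (everything PROVED; kernel calculus and measure theory on
`ℝ³ = EuclideanSpace ℝ (Fin 3)`) for the proof of the named fact
`Literature.Analysis.FluidPDE.leray_solution_pressure_decay` (**Dp**, `LerayPressureDecay.lean`)
from the local pressure expansion of Kang–Miura–Tsai 2021, Lemma 3.4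
(`LocalLerayPressureDecomposition.lean`). The far-field term of that expansion,
`π_far(t,x) = ∫_{|y-x₀| ≥ 2r} (K(x-y) - K(x₀-y)) : (v ⊗ v)(y,t) dy` (`x ∈ B_r(x₀)`), is
controlled in print by "a pointwise bound,
`|p_far(x,t)| ≤ ∫_{2R<|y-x₀|} cR|x₀-y|⁻⁴ |v(y,t)|² dy ≤ Σ_{0≠k∈ℤ³} ∫_{B_R(x₀+Rk)} cR|Rk|⁻⁴|v|² ≤
c R⁻³ ‖v(t)‖²_{L²_{uloc,R}}`" (Kang–Miura–Tsai, arXiv:1812.10509, §8 p. 18; Kikuchi–Seregin 2007,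
proof of Lemma 2.2). This file proves the three ingredients of that display in the form the
tree's assembly uses:

* `exists_abs_pressureKernel_sub_le` — **the two-centre (Hörmander) bound for the pressure
  kernel** `K(z)(a) = (3⟨z,a⟩² - |a|²|z|²)/(4π|z|⁵)` (`pressureKernel`, `= -D²Γ(z)(a,a)` with
  `Γ = -1/(4π|z|)`, `pressureKernel_eq_neg_fderiv2`): there is `C` with
  `|K(x-y)(a) - K(x₀-y)(a)| ≤ C |x-x₀| |a|² / |y-x₀|⁴` whenever `2|x-x₀| ≤ |y-x₀|`, `y ≠ x₀`
  (mean value theorem for `D²Γ` on the segment `[x₀-y, x-y]`, which stays at distance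
  `≥ |y-x₀|/2` from the origin, and `‖D³Γ(z)‖ ≤ M|z|⁻⁴` by homogeneity,
  `exists_norm_fderiv3_newtonKernel_le`);
* `lintegral_mul_le_of_forall_lintegral_ball_le` — **weighted integrals of uniformly locally
  `L²` functions** (the lattice sum of the display, done by integrating the unit-ball bounds
  over all centres instead of summing over `ℤ³`): if `∫_{B_1(z)} g ≤ A` for every centre `z`
  and `W(y) ≤ w(z)` whenever `|z-y| < 1`, then `∫ g W ≤ |B_1|⁻¹ A ∫ w`; with the comparison
  `|y-x₀|⁻⁴ ≤ 16|z-x₀|⁻⁴` for `|z-y| < 1 ≤ |y-x₀|/2` (`powKer_four_le_of_dist_lt_one`);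
* `tendsto_lintegral_compl_ball_powKer_four_atTop` — **the tail** `∫_{|z| ≥ ρ} |z|⁻⁴ dz → 0` as
  `ρ → ∞` (dominated convergence against `1_{|z|≥1}|z|⁻⁴ ∈ L¹`,
  `RieszKernel.lintegral_compl_ball_powKer_lt_top`), and translation invariance
  `setLIntegral_compl_ball_comp_sub`.

## Mathlib / tree search

Tree: `pressureKernel_eq_neg_fderiv2` (`PressureRepresentation.lean`),
`fderiv3_newtonKernel_homogeneous`, `contDiffOn_fderiv2_newtonKernel`,
`contDiffOn_fderiv3_newtonKernel`, `exists_bound_of_homogeneous` (`NewtonKernel.lean`),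
`RieszKernel.powKer`, `measurable_powKer`, `lintegral_compl_ball_powKer_lt_top`
(`RieszKernelBounds.lean`). Mathlib: `Convex.norm_image_sub_le_of_norm_fderiv_le`,
`lintegral_lintegral_swap`, `tendsto_lintegral_filter_of_dominated_convergence`,
`lintegral_sub_right_eq_self`, `Measure.addHaar_ball_center`.

## References

* K. Kang, H. Miura, T.-P. Tsai, IMRN 2021 = arXiv:1812.10509, §8 (proof of Lemma 3.4, the
  bound on `p_far`, p. 18). Bib key `KangMiuraTsai2020`.
* N. Kikuchi, G. Seregin, AMS Transl. (2) 220 (2007), proof of Lemma 2.2. Bib key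
  `KikuchiSeregin2007`.
* E. M. Stein, *Singular integrals* (1970), Ch. II §4.2 (the Hörmander condition for
  `Ω(x)/|x|ⁿ`). Bib key `Stein1971`.
-/

noncomputable section

open _root_.MeasureTheory _root_.TopologicalSpace _root_.Metric _root_.Filter _root_.Set
  _root_.Function
open scoped _root_.ENNReal _root_.NNReal _root_.Topology

namespace Literature.Analysis.FluidPDE

/-! ## The two-centre bound for the pressure kernel -/

section Kernel

-- nested operator types `ℝ³ →L[ℝ] ℝ³ →L[ℝ] ℝ³ →L[ℝ] ℝ`
set_option maxSynthPendingDepth 3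

/-- **`‖D³Γ(z)‖ ≤ M |z|⁻⁴`** for the Newtonian kernel `Γ = -1/(4π|z|)` of `ℝ³`: `D³Γ` is
continuous off the origin and homogeneous of degree `-4` (`fderiv3_newtonKernel_homogeneous`),
hence bounded on the unit sphere and then everywhere by scaling. [folklore] -/
theorem exists_norm_fderiv3_newtonKernel_le :
    ∃ M : ℝ, 0 ≤ M ∧ ∀ z : (EuclideanSpace ℝ (Fin 3)), z ≠ 0 →
      ‖fderiv ℝ (fderiv ℝ (fderiv ℝ newtonKernel)) z‖ ≤ M / ‖z‖ ^ 4 := by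
  obtain ⟨M, hM⟩ := exists_bound_of_homogeneous _ (-4) (by norm_num)
    fderiv3_newtonKernel_homogeneous (contDiffOn_fderiv3_newtonKernel (n := 0)).continuousOn
    one_pos
  refine ⟨max M 0, le_max_right _ _, fun z hz => ?_⟩
  have hz' : 0 < ‖z‖ := norm_pos_iff.2 hz
  set c := ‖z‖ with hc
  set w : (EuclideanSpace ℝ (Fin 3)) := c⁻¹ • z with hw
  have hwn : ‖w‖ = 1 := by
    rw [hw, norm_smul, norm_inv, norm_norm, inv_mul_cancel₀ hz'.ne']
  have hzw : z = c • w := by rw [hw, smul_smul, mul_inv_cancel₀ hz'.ne', one_smul]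
  have h1 := fderiv3_newtonKernel_homogeneous c hz' w
  rw [← hzw] at h1
  rw [h1, norm_smul, norm_zpow, Real.norm_eq_abs, abs_of_pos hz']
  have h2 : ‖fderiv ℝ (fderiv ℝ (fderiv ℝ newtonKernel)) w‖ ≤ max M 0 :=
    (hM w (by rw [hwn])).trans (le_max_left _ _)
  have h3 : c ^ (-4 : ℤ) = 1 / ‖z‖ ^ 4 := by
    rw [hc, zpow_neg, zpow_ofNat, one_div]
  rw [h3]
  calc 1 / ‖z‖ ^ 4 * ‖fderiv ℝ (fderiv ℝ (fderiv ℝ newtonKernel)) w‖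
      ≤ 1 / ‖z‖ ^ 4 * max M 0 := by gcongr
    _ = max M 0 / ‖z‖ ^ 4 := by ring

/-- Points of the segment `[z', z]` have norm at least `‖z'‖ - ‖z - z'‖`. [folklore] -/
theorem norm_sub_norm_le_of_mem_segment {z z' s : (EuclideanSpace ℝ (Fin 3))} (hs : s ∈ segment ℝ z' z) :
    ‖z'‖ - ‖z - z'‖ ≤ ‖s‖ := by
  obtain ⟨a, b, _, hb, hab, rfl⟩ := hs
  have e : a • z' + b • z = z' + b • (z - z') := by
    rw [show a = 1 - b by linarith, sub_smul, one_smul, smul_sub]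
    abel
  rw [e]
  have h1 : ‖z'‖ ≤ ‖z' + b • (z - z')‖ + ‖b • (z - z')‖ := by
    have := norm_sub_le (z' + b • (z - z')) (b • (z - z'))
    rwa [add_sub_cancel_right] at this
  have h2 : ‖b • (z - z')‖ ≤ ‖z - z'‖ := by
    rw [norm_smul, Real.norm_eq_abs, abs_of_nonneg hb]
    have hb1 : b ≤ 1 := by linarith
    exact mul_le_of_le_one_left (norm_nonneg _) hb1
  linarith

/-- **The two-centre (Hörmander) bound for the pressure kernel.** There is a constant `C` such
that for all `x₀, x, y, a ∈ ℝ³` with `2|x - x₀| ≤ |y - x₀|` and `y ≠ x₀`,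
`|K(x-y)(a) - K(x₀-y)(a)| ≤ C |x - x₀| |a|² / |y - x₀|⁴` (mean value theorem for `D²Γ` along the
segment from `x₀ - y` to `x - y`, on which `|·| ≥ |y - x₀|/2`, with `‖D³Γ(z)‖ ≤ M|z|⁻⁴`; this is
the kernel estimate behind "`|p_far(x,t)| ≤ ∫_{2R<|y-x₀|} cR|x₀-y|⁻⁴|v(y,t)|² dy`" of
Kang–Miura–Tsai 2021, §8, and the Hörmander condition of Stein, Ch. II §4.2).
[cite: KangMiuraTsai2020, §8 proof of Lemma 3.4 (pointwise bound for p_far), arXiv:1812.10509 p. 18] -/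
theorem exists_abs_pressureKernel_sub_le :
    ∃ C : ℝ, 0 ≤ C ∧ ∀ x₀ x y a : (EuclideanSpace ℝ (Fin 3)), 2 * ‖x - x₀‖ ≤ ‖y - x₀‖ → y ≠ x₀ →
      |pressureKernel (x - y) a - pressureKernel (x₀ - y) a| ≤
        C * ‖x - x₀‖ * ‖a‖ ^ 2 / ‖y - x₀‖ ^ 4 := by
  obtain ⟨M, hM0, hM⟩ := exists_norm_fderiv3_newtonKernel_le
  refine ⟨16 * M, by positivity, fun x₀ x y a hxy hy => ?_⟩
  set F := fderiv ℝ (fderiv ℝ newtonKernel) with hF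
  set z : (EuclideanSpace ℝ (Fin 3)) := x - y with hz
  set z' : (EuclideanSpace ℝ (Fin 3)) := x₀ - y with hz'
  have hd : 0 < ‖y - x₀‖ := norm_pos_iff.2 (sub_ne_zero.2 hy)
  set ρ : ℝ := ‖y - x₀‖ / 2 with hρ
  have hρ0 : 0 < ρ := by positivity
  have hzz' : z - z' = x - x₀ := by rw [hz, hz']; abel
  have hz'n : ‖z'‖ = ‖y - x₀‖ := by rw [hz', norm_sub_rev]
  -- every point of the segment has norm at least `ρ`
  have hseg : ∀ s ∈ segment ℝ z' z, ρ ≤ ‖s‖ := fun s hs => by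
    have h1 := norm_sub_norm_le_of_mem_segment hs
    rw [hzz', hz'n] at h1
    rw [hρ]
    linarith
  have hne : ∀ s ∈ segment ℝ z' z, s ≠ 0 := fun s hs h0 => by
    have := hseg s hs
    rw [h0, norm_zero] at this
    linarith
  -- differentiability of `D²Γ` on the segment and the derivative bound
  have hdiff : ∀ s ∈ segment ℝ z' z, DifferentiableAt ℝ F s := fun s hs =>
    ((contDiffOn_fderiv2_newtonKernel (n := 1)).differentiableOn one_ne_zero).differentiableAt
      (isOpen_compl_singleton.mem_nhds (hne s hs))
  have hbound : ∀ s ∈ segment ℝ z' z, ‖fderiv ℝ F s‖ ≤ M / ρ ^ 4 := fun s hs => by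
    calc ‖fderiv ℝ F s‖ ≤ M / ‖s‖ ^ 4 := hM s (hne s hs)
      _ ≤ M / ρ ^ 4 := by
          apply div_le_div_of_nonneg_left hM0 (pow_pos hρ0 4)
          exact pow_le_pow_left₀ hρ0.le (hseg s hs) 4
  have hMVT := (convex_segment z' z).norm_image_sub_le_of_norm_fderiv_le hdiff hbound
    (left_mem_segment ℝ z' z) (right_mem_segment ℝ z' z)
  -- `K = -D²Γ` at the two (non-zero) points
  have hz0 : z ≠ 0 := hne z (right_mem_segment ℝ z' z)
  have hz'0 : z' ≠ 0 := hne z' (left_mem_segment ℝ z' z)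
  rw [pressureKernel_eq_neg_fderiv2 hz0, pressureKernel_eq_neg_fderiv2 hz'0, ← hF]
  have e1 : -F z a a - -F z' a a = -((F z - F z') a a) := by
    simp only [_root_.sub_apply]
    ring
  rw [e1, abs_neg]
  calc |(F z - F z') a a| ≤ ‖(F z - F z') a‖ * ‖a‖ := by
        rw [← Real.norm_eq_abs]
        exact ((F z - F z') a).le_opNorm a
    _ ≤ ‖F z - F z'‖ * ‖a‖ * ‖a‖ := by
        gcongr
        exact (F z - F z').le_opNorm a
    _ ≤ M / ρ ^ 4 * ‖z - z'‖ * ‖a‖ * ‖a‖ := by gcongr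
    _ = 16 * M * ‖x - x₀‖ * ‖a‖ ^ 2 / ‖y - x₀‖ ^ 4 := by
        rw [hzz', hρ]
        field_simp
        ring

end Kernel

/-! ## Weighted integrals of uniformly locally `L²` functions -/

/-- **Weighted integrals from uniformly local bounds.** If `g ≥ 0` has `∫_{B_1(z)} g ≤ A` for
every centre `z`, and the weight `W` is dominated on unit distance by `w`
(`W(y) ≤ w(z)` whenever `|z - y| < 1`), then `∫ g W ≤ |B_1|⁻¹ A ∫ w` (average the ball bound over
all centres: `|B_1| ∫ g W = ∫_y ∫_{|z-y|<1} g(y)W(y) ≤ ∫_z w(z) ∫_{B_1(z)} g ≤ A ∫ w`). This is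
the continuous form of the lattice sum `Σ_{k ∈ ℤ³} ∫_{B_R(x₀+Rk)} |Rk|⁻⁴ |v|²` in
Kang–Miura–Tsai 2021, §8 / Kikuchi–Seregin 2007, Lemma 2.2. [folklore] -/
theorem lintegral_mul_le_of_forall_lintegral_ball_le {g w W : (EuclideanSpace ℝ (Fin 3)) → ℝ≥0∞}
    (hg : AEMeasurable g volume) (hw : AEMeasurable w volume) {A : ℝ≥0∞}
    (hA : ∀ z : (EuclideanSpace ℝ (Fin 3)), ∫⁻ y in ball z 1, g y ≤ A) (hWw : ∀ y z : (EuclideanSpace ℝ (Fin 3)), dist z y < 1 → W y ≤ w z) :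
    ∫⁻ y, g y * W y ≤ (volume (ball (0 : (EuclideanSpace ℝ (Fin 3))) 1))⁻¹ * (A * ∫⁻ z, w z) := by
  set V := volume (ball (0 : (EuclideanSpace ℝ (Fin 3))) 1) with hV
  have hV0 : V ≠ 0 := (measure_ball_pos volume _ one_pos).ne'
  have hVt : V ≠ ⊤ := measure_ball_lt_top.ne
  rw [← ENNReal.mul_le_iff_le_inv hV0 hVt]
  -- `V ∫ g W = ∫_y ∫_{z ∈ B(y,1)} g(y) W(y)`
  have h1 : V * ∫⁻ y, g y * W y = ∫⁻ y, ∫⁻ _ in ball y 1, g y * W y := by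
    rw [mul_comm, ← lintegral_mul_const' _ _ hVt]
    refine lintegral_congr fun y => ?_
    rw [setLIntegral_const, Measure.addHaar_ball_center volume y 1]
  -- the kernel of the double integral
  set Φ : (EuclideanSpace ℝ (Fin 3)) → (EuclideanSpace ℝ (Fin 3)) → ℝ≥0∞ := fun y z => (ball y 1).indicator (fun z => g y * w z) z with hΦ
  have hΦm : AEMeasurable (uncurry Φ) (volume.prod volume) := by
    have e : uncurry Φ =
        {p : (EuclideanSpace ℝ (Fin 3)) × (EuclideanSpace ℝ (Fin 3)) | dist p.2 p.1 < 1}.indicator fun p => g p.1 * w p.2 := by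
      funext p
      simp only [hΦ, uncurry, indicator, mem_ball, mem_setOf_eq]
    rw [e]
    refine (hg.comp_fst.mul hw.comp_snd).indicator ?_
    exact (isOpen_lt (continuous_snd.dist continuous_fst) continuous_const).measurableSet
  have h2 : ∫⁻ y, ∫⁻ _ in ball y 1, g y * W y ≤ ∫⁻ y, ∫⁻ z, Φ y z := by
    refine lintegral_mono fun y => ?_
    rw [hΦ, lintegral_indicator measurableSet_ball]
    refine setLIntegral_mono' measurableSet_ball fun z hz => ?_
    exact mul_le_mul' le_rfl (hWw y z (mem_ball.1 hz))
  have h3 : ∫⁻ y, ∫⁻ z, Φ y z = ∫⁻ z, ∫⁻ y, Φ y z := lintegral_lintegral_swap hΦm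
  have h4 : ∀ z, ∫⁻ y, Φ y z = (∫⁻ y in ball z 1, g y) * w z := fun z => by
    have e : (fun y => Φ y z) = (ball z 1).indicator fun y => g y * w z := by
      funext y
      simp only [hΦ, indicator, mem_ball]
      rw [dist_comm]
    rw [e, lintegral_indicator measurableSet_ball, lintegral_mul_const'' _ hg.restrict]
  calc V * ∫⁻ y, g y * W y = ∫⁻ y, ∫⁻ _ in ball y 1, g y * W y := h1
    _ ≤ ∫⁻ y, ∫⁻ z, Φ y z := h2
    _ = ∫⁻ z, ∫⁻ y, Φ y z := h3
    _ = ∫⁻ z, (∫⁻ y in ball z 1, g y) * w z := lintegral_congr h4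
    _ ≤ ∫⁻ z, A * w z := lintegral_mono fun z => mul_le_mul' (hA z) le_rfl
    _ = A * ∫⁻ z, w z := lintegral_const_mul'' _ hw

/-- **Comparison of the far-field weight on unit distance**: if `2 ≤ ρ ≤ |y - x₀|` and
`|z - y| < 1` then `|y - x₀|⁻⁴ ≤ 16 |z - x₀|⁻⁴` and `ρ - 1 ≤ |z - x₀|` (as `|z - x₀| ≤ 2|y - x₀|`).
[folklore] -/
theorem powKer_four_le_of_dist_lt_one {x₀ y z : (EuclideanSpace ℝ (Fin 3))} {ρ : ℝ} (hρ : 2 ≤ ρ) (hy : ρ ≤ ‖y - x₀‖)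
    (hz : dist z y < 1) :
    RieszKernel.powKer 4 (y - x₀) ≤ 16 * RieszKernel.powKer 4 (z - x₀) ∧ ρ - 1 ≤ ‖z - x₀‖ := by
  have hzy : ‖z - y‖ < 1 := by rwa [← dist_eq_norm]
  have htri : ‖z - x₀‖ ≤ ‖z - y‖ + ‖y - x₀‖ := norm_sub_le_norm_sub_add_norm_sub z y x₀
  have htri' : ‖y - x₀‖ ≤ ‖y - z‖ + ‖z - x₀‖ := norm_sub_le_norm_sub_add_norm_sub y z x₀
  have hyz : ‖y - z‖ < 1 := by rwa [norm_sub_rev]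
  refine ⟨?_, by linarith⟩
  have hy0 : 0 < ‖y - x₀‖ := by linarith
  have hz0 : 0 < ‖z - x₀‖ := by linarith
  have hle : ‖z - x₀‖ / 2 ≤ ‖y - x₀‖ := by linarith
  rw [RieszKernel.powKer_apply, RieszKernel.powKer_apply,
    ← ENNReal.ofReal_ofNat 16, ← ENNReal.ofReal_mul (by norm_num)]
  refine ENNReal.ofReal_le_ofReal ?_
  have h1 : ‖y - x₀‖ ^ (-4 : ℝ) ≤ (‖z - x₀‖ / 2) ^ (-4 : ℝ) :=
    Real.rpow_le_rpow_of_nonpos (by positivity) hle (by norm_num)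
  have h2 : (‖z - x₀‖ / 2) ^ (-4 : ℝ) = 16 * ‖z - x₀‖ ^ (-4 : ℝ) := by
    rw [Real.div_rpow (norm_nonneg _) (by norm_num), Real.rpow_neg (by norm_num : (0 : ℝ) ≤ 2),
      show (4 : ℝ) = ((4 : ℕ) : ℝ) by norm_num, Real.rpow_natCast]
    norm_num
    ring
  rw [← h2]
  exact h1

/-- Translation invariance for kernel integrals off balls: `∫_{B(c,R)ᶜ} k(x − c) = ∫_{B(0,R)ᶜ} k`.
[folklore] -/
theorem setLIntegral_compl_ball_comp_sub (k : (EuclideanSpace ℝ (Fin 3)) → ℝ≥0∞) (c : (EuclideanSpace ℝ (Fin 3))) (R : ℝ) :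
    ∫⁻ x in (ball c R)ᶜ, k (x - c) = ∫⁻ x in (ball (0 : (EuclideanSpace ℝ (Fin 3))) R)ᶜ, k x := by
  rw [← lintegral_indicator measurableSet_ball.compl,
    ← lintegral_indicator measurableSet_ball.compl]
  have e : (ball c R)ᶜ.indicator (fun x => k (x - c)) =
      fun x => (ball (0 : (EuclideanSpace ℝ (Fin 3))) R)ᶜ.indicator k (x - c) := by
    funext x
    simp only [indicator, mem_compl_iff, mem_ball, dist_eq_norm, sub_zero]
  rw [e]
  exact lintegral_sub_right_eq_self (μ := (volume : Measure (EuclideanSpace ℝ (Fin 3)))) ((ball (0 : (EuclideanSpace ℝ (Fin 3))) R)ᶜ.indicator k) c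

/-! ## The tail of `∫ |z|⁻⁴` -/

/-- **The tail of the integrable kernel `|z|⁻⁴` on `ℝ³`**: `∫_{|z| ≥ ρ} |z|⁻⁴ dz → 0` as
`ρ → ∞` (dominated convergence: for `ρ ≥ 1` the integrands are dominated by
`1_{|z| ≥ 1}|z|⁻⁴ ∈ L¹` and tend to `0` pointwise). [folklore] -/
theorem tendsto_lintegral_compl_ball_powKer_four_atTop :
    Tendsto (fun ρ : ℝ => ∫⁻ z in (ball (0 : (EuclideanSpace ℝ (Fin 3))) ρ)ᶜ, RieszKernel.powKer 4 z) atTop (𝓝 0) := by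
  have e : (fun ρ : ℝ => ∫⁻ z in (ball (0 : (EuclideanSpace ℝ (Fin 3))) ρ)ᶜ, RieszKernel.powKer 4 z) =
      fun ρ : ℝ => ∫⁻ z, (ball (0 : (EuclideanSpace ℝ (Fin 3))) ρ)ᶜ.indicator (RieszKernel.powKer 4) z := by
    funext ρ
    rw [lintegral_indicator measurableSet_ball.compl]
  rw [e, ← lintegral_zero (μ := (volume : Measure (EuclideanSpace ℝ (Fin 3))))]
  refine tendsto_lintegral_filter_of_dominated_convergence
    ((ball (0 : (EuclideanSpace ℝ (Fin 3))) 1)ᶜ.indicator (RieszKernel.powKer 4))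
    (Eventually.of_forall fun ρ =>
      (RieszKernel.measurable_powKer 4).indicator measurableSet_ball.compl) ?_ ?_ ?_
  · filter_upwards [eventually_ge_atTop (1 : ℝ)] with ρ hρ
    refine Eventually.of_forall fun z => ?_
    refine indicator_le_indicator_of_subset (compl_subset_compl.2 (ball_subset_ball hρ))
      (fun _ => zero_le) z
  · rw [lintegral_indicator measurableSet_ball.compl]
    exact (RieszKernel.lintegral_compl_ball_powKer_lt_top (by norm_num) one_pos).ne
  · refine Eventually.of_forall fun z => ?_
    refine tendsto_const_nhds.congr' ?_
    filter_upwards [eventually_gt_atTop ‖z‖] with ρ hρ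
    rw [indicator_of_notMem]
    rw [mem_compl_iff, not_not, mem_ball_zero_iff]
    exact hρ

end Literature.Analysis.FluidPDE
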